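import Literature.Computability.MetaComplexity.RamseyTautologiesProofs
import Literature.Computability.MetaComplexity.KEvaluations
import Literature.Computability.MetaComplexity.FregeMod
import Literature.Computability.MetaComplexity.FpLinearSystems
import HarnessLib

/-!
# Bounded-depth `textbookFrege` refutes every unsatisfiable CNF (calibration of the
`ExpanderLinearGenerators` ladder rungs)

Support file for item `stmt-PneNP-11444` (`LinearGeneratorModPFregeHard`, the `AC⁰[p]`-Frege
rung of route `ExpanderLinearGenerators`) and its siblings `stmt-PneNP-11442/11443`: all three
rungs conclude a SIZE lower bound for every depth-`d` `textbookFrege` (resp.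
`textbookFrege(MOD_p)`) proof `π` of the target `¬ ofCNF (sumEncoding 1 E)`.  For `d ≤ 4` no
such `π` exists at all (the target line alone has alternation depth `4`, and it can only be
inferred by contraction from `¬Φ ∨ ¬Φ`, of depth `5`), so those slices are vacuous.  This file
proves the complementary CALIBRATION fact: from a fixed constant depth on, proofs DO exist for
every unsolvable system, so the universally quantified `π` ranges over a nonempty set and the
rung asserts a genuine (open: Krajíček 2019, Problem 15.6.1) exponential size lower bound.

* `exists_isDepthProofOf_neg_ofCNF` — **refutation completeness of bounded-depth Frege**: every
  unsatisfiable CNF `φ` over `ℕ` has a depth-`30` `textbookFrege` proof of `¬ ofCNF φ`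
  (the brute-force decision tree over the variables `x₀, …, x_{numVars-1}`, read as a
  one-sided sequent calculus derivation with the toolkit `DepthFrege.Sq` of
  `DepthFregeSequents.lean`; the constant `30 = 4 + 26` is the toolkit's overhead over the
  depth `4` of the target).
* `exists_isModDepthProofOf_neg_ofCNF` — the same proof read in `textbookFrege(MOD_a)`.
* `exists_isModDepthProofOf_sumEncoding` — for every unsolvable system `E` over `𝔽₂` and every
  `d ≥ 30` there is a depth-`d` `textbookFrege(MOD_p)` proof of the route target
  `ofPropForm (¬ ofCNF (sumEncoding 1 E))` — the `π`-quantifier of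
  `LinearGeneratorModPFregeHard` (and of the two `AC⁰` rungs) is inhabited for `d ≥ 30`.

Sources: J. Krajíček, *Bounded arithmetic, propositional logic, and complexity theory*
(CUP 1995), §4.3–4.4 (depth; every tautology has a bounded-depth "brute force" Frege proof);
J. R. Shoenfield, *Mathematical Logic* (1967), §3.1 (tautology theorem) — as organised in
`TextbookFregeCompleteness.lean` / `DepthFregeSequents.lean`.  The statements are folklore.
-/

set_option linter.dupNamespace false -- `Summit.PneNP.PneNP.…`: summit = sub-problem (D-0017)

namespace Summit.PneNP.PneNP.Theorems

open Literature.Computability.Complexity Literature.Computability.Complexity.PropForm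
open Literature.Computability.MetaComplexity
open Literature.Computability.MetaComplexity.DepthFrege
open Literature.Computability.MetaComplexity.TextbookFrege (disjList disjList_nil disjList_cons
  conjList conjList_nil conjList_cons)
open Literature.Computability.MetaComplexity.KEval (litForm clauseForm clauseForm_cons ofCNF_cons)

/-! ### Syntax of the target: `ofCNF φ = ⋀ (clause formulas)`, depth and size facts -/

/-- `ofCNF` is the list conjunction of the clause formulas. [folklore] -/
theorem ofCNF_eq_conjList (φ : CNF ℕ) : PropForm.ofCNF φ = conjList (φ.map clauseForm) := by
  induction φ with
  | nil => rfl
  | cons c φ ih => rw [ofCNF_cons, List.map_cons, conjList_cons, ih]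

/-- A literal formula has alternation depth at most `1`. [folklore] -/
theorem altDepthAux_litForm_le (c : ℕ) (l : Literal ℕ) : altDepthAux c (litForm l) ≤ 1 := by
  unfold litForm
  split_ifs
  · simp [altDepthAux]
  · simp only [altDepthAux]
    split_ifs <;> simp

/-- A literal formula has size at most `2`. [folklore] -/
theorem size_litForm_le (l : Literal ℕ) : (litForm l).size ≤ 2 := by
  unfold litForm
  split_ifs <;> simp [PropForm.size]

/-- A clause formula has auxiliary depth at most `2` below any parent. [folklore] -/
theorem altDepthAux_clauseForm_le (c : ℕ) (cl : Clause ℕ) : altDepthAux c (clauseForm cl) ≤ 2 := by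
  suffices h : altDepthAux 3 (clauseForm cl) ≤ 1 by
    have := altDepthAux_le_altDepthAux_succ c 3 (clauseForm cl)
    omega
  induction cl with
  | nil => simp [clauseForm]
  | cons l cl ih =>
    rw [clauseForm_cons]
    simp only [altDepthAux, if_true, add_zero, max_le_iff]
    exact ⟨altDepthAux_litForm_le 3 l, ih⟩

/-- The negated CNF formula `¬ ofCNF φ` has alternation depth at most `4`. [folklore] -/
theorem altDepth_neg_ofCNF_le (φ : CNF ℕ) : (PropForm.neg (PropForm.ofCNF φ)).altDepth ≤ 4 := by
  suffices h : altDepthAux 2 (PropForm.ofCNF φ) ≤ 2 by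
    have := altDepthAux_le_altDepthAux_succ 1 2 (PropForm.ofCNF φ)
    simp only [altDepth, altDepthAux, show (0 : ℕ) ≠ 1 from by decide, if_false]
    omega
  induction φ with
  | nil => simp [PropForm.ofCNF]
  | cons c φ ih =>
    rw [ofCNF_cons]
    simp only [altDepthAux, if_true, add_zero, max_le_iff]
    exact ⟨altDepthAux_clauseForm_le 2 c, ih⟩

/-! ### Base formulas of the construction -/

section Construction

variable {Q : SPrm}

/-- Literal formulas are admissible sequent members for every parameter set. [folklore] -/
theorem base_litForm (Q : SPrm) (l : Literal ℕ) : Base Q (litForm l) :=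
  ⟨(altDepthAux_litForm_le 0 l).trans (by have := Q.hD; omega),
    (size_litForm_le l).trans Q.hM⟩

/-- If `¬⋀M` is admissible then so is `¬A` for every member `A ∈ M`. [folklore] -/
theorem base_neg_of_mem_conjList {M : List (PropForm ℕ)} (hM : Base Q (PropForm.neg (conjList M)))
    {A : PropForm ℕ} (hA : A ∈ M) : Base Q (PropForm.neg A) := by
  induction M with
  | nil => simp at hA
  | cons X M ih =>
    rw [conjList_cons] at hM
    rcases List.mem_cons.1 hA with rfl | hA
    · exact hM.neg_of_negConj_left
    · exact ih hM.neg_of_negConj_right hA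

/-! ### Step 1: a falsified clause, negated, joins the context of its (false) literals -/

/-- `⊢ ¬(l₁ ∨ ⋯ ∨ l_k ∨ ⊥), L` whenever every `lᵢ` occurs in `L` (iterated `¬∨`-rule over the
axioms `⊢ ¬lᵢ, L` and `⊢ ¬⊥, L`). [Shoenfield 1967, §3.1] [folklore] -/
theorem sq_neg_clauseForm {L : List (PropForm ℕ)} (hL : ∀ A ∈ L, Base Q A)
    (hW : L.length + 1 ≤ Q.W) :
    ∀ c : Clause ℕ, (∀ l ∈ c, litForm l ∈ L) → Base Q (PropForm.neg (clauseForm c)) →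
      ∃ t, Sq Q t (PropForm.neg (clauseForm c) :: L)
  | [], _, hb => by
    refine ⟨1, Sq.negBotMem (L := PropForm.neg (clauseForm []) :: L) ?_ (by simp; omega)
      (by simp [clauseForm])⟩
    intro A hA
    rcases List.mem_cons.1 hA with rfl | hA
    · exact hb
    · exact hL A hA
  | l :: c, hc, hb => by
    rw [clauseForm_cons] at hb ⊢
    obtain ⟨t, ht⟩ := sq_neg_clauseForm hL hW c (fun l' hl' => hc l' (List.mem_cons_of_mem _ hl'))
      hb.neg_of_negDisj_right
    have hax : Sq Q 1 (PropForm.neg (litForm l) :: L) := by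
      refine Sq.ax (A := litForm l) ?_ (by simp; omega)
        (List.mem_cons_of_mem _ (hc l List.mem_cons_self)) List.mem_cons_self
      intro A hA
      rcases List.mem_cons.1 hA with rfl | hA
      · exact hb.neg_of_negDisj_left
      · exact hL A hA
    exact ⟨_, Sq.consNegDisj hax ht hb⟩

/-! ### Step 2: the leaves of the decision tree -/

/-- **Leaf.** If the total assignment `ρ` falsifies `φ` and `Done` lists all variables of `φ`,
then `⊢ ¬⋀φ, K` for the context `K` of the literals falsified by `ρ` on `Done`: some clause
`c` of `φ` is false under `ρ`, all its literals lie in `K`, so `⊢ ¬c, K` (`sq_neg_clauseForm`)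
and `¬c ⊢ ¬⋀φ` (`Sq.negAndOfMem`). [Krajíček 1995, §4.3] [folklore] -/
theorem sq_leaf {φ : CNF ℕ} (hΦ : Base Q (PropForm.neg (PropForm.ofCNF φ))) (Done : List ℕ)
    (ρ : ℕ → Bool) (hρ : φ.eval ρ = false) (hcov : ∀ c ∈ φ, ∀ l ∈ c, l.1 ∈ Done)
    (hW : Done.length + 3 ≤ Q.W) :
    ∃ t, Sq Q t (PropForm.neg (PropForm.ofCNF φ) :: Done.map fun x => litForm (x, !ρ x)) := by
  -- a falsified clause
  obtain ⟨c, hcφ, hc⟩ : ∃ c ∈ φ, c.eval ρ = false := by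
    by_contra h
    have hall : φ.eval ρ = true := (CNF.eval_eq_true_iff φ ρ).2 fun c hc => by
      cases hce : c.eval ρ
      · exact absurd ⟨c, hc, hce⟩ h
      · rfl
    rw [hρ] at hall
    exact Bool.false_ne_true hall
  -- its literals are among the context
  have hlit : ∀ l ∈ c, litForm l ∈ Done.map fun x => litForm (x, !ρ x) := by
    intro l hl
    have hfalse : Literal.eval ρ l = false := by
      have : c.any (Literal.eval ρ) = false := hc
      exact List.any_eq_false.1 this l hl |> Bool.eq_false_iff.2
    have hpol : l.2 = !ρ l.1 := by
      unfold Literal.eval at hfalse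
      cases h1 : ρ l.1 <;> cases h2 : l.2 <;> simp_all
    refine List.mem_map.2 ⟨l.1, hcov c hcφ l hl, ?_⟩
    rw [← hpol]
  have hK : ∀ A ∈ Done.map (fun x => litForm (x, !ρ x)), Base Q A := by
    intro A hA
    obtain ⟨x, -, rfl⟩ := List.mem_map.1 hA
    exact base_litForm Q _
  rw [ofCNF_eq_conjList] at hΦ ⊢
  have hcM : clauseForm c ∈ φ.map clauseForm := List.mem_map_of_mem hcφ
  obtain ⟨t, ht⟩ := sq_neg_clauseForm hK (by simp; omega) c hlit (base_neg_of_mem_conjList hΦ hcM)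
  exact ⟨_, Sq.negAndOfMem (by simp; omega) (φ.map clauseForm) hcM hΦ ht⟩

/-! ### Step 3: the decision tree -/

/-- **Decision tree.** For every list `W` of variables still to be queried (the variables of `φ`
being among `Done ++ W`, without repetitions) and every assignment `ρ` of the queried ones,
`⊢ ¬⋀φ, K_ρ(Done)`: query the next variable `x`, obtain `⊢ ¬⋀φ, K, x` and `⊢ ¬⋀φ, K, ¬x` from the
two extensions of `ρ`, and cut on `x`. [Krajíček 1995, §4.3 (brute-force bounded-depth proofs)]
[folklore] -/
theorem sq_tree {φ : CNF ℕ} (hφ : ¬ φ.Satisfiable) (hΦ : Base Q (PropForm.neg (PropForm.ofCNF φ))) :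
    ∀ (W Done : List ℕ) (ρ : ℕ → Bool), (Done ++ W).Nodup → (∀ c ∈ φ, ∀ l ∈ c, l.1 ∈ Done ++ W) →
      Done.length + W.length + 3 ≤ Q.W →
      ∃ t, Sq Q t (PropForm.neg (PropForm.ofCNF φ) :: Done.map fun x => litForm (x, !ρ x))
  | [], Done, ρ, _, hcov, hW => by
    have hρ : φ.eval ρ = false := by
      cases h : φ.eval ρ
      · rfl
      · exact absurd ⟨ρ, h⟩ hφ
    exact sq_leaf hΦ Done ρ hρ (by simpa using hcov) (by simpa using hW)
  | x :: W, Done, ρ, hnd, hcov, hW => by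
    have hx : x ∉ Done := by
      intro hx
      rw [List.nodup_append] at hnd
      exact hnd.2.2 x hx x List.mem_cons_self rfl
    have hnd' : (Done ++ [x] ++ W).Nodup := by simpa using hnd
    have hcov' : ∀ c ∈ φ, ∀ l ∈ c, l.1 ∈ Done ++ [x] ++ W := by simpa using hcov
    have hW' : (Done ++ [x]).length + W.length + 3 ≤ Q.W := by
      simp only [List.length_append, List.length_cons, List.length_nil] at hW ⊢; omega
    -- the two sons
    have son : ∀ b : Bool, ∃ t, Sq Q t (litForm (x, !b) :: PropForm.neg (PropForm.ofCNF φ) ::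
        Done.map fun y => litForm (y, !ρ y)) := by
      intro b
      obtain ⟨t, ht⟩ := sq_tree hφ hΦ W (Done ++ [x]) (Function.update ρ x b) hnd' hcov' hW'
      have hmap : (Done ++ [x]).map (fun y => litForm (y, !(Function.update ρ x b y))) =
          (Done.map fun y => litForm (y, !ρ y)) ++ [litForm (x, !b)] := by
        rw [List.map_append, List.map_singleton, Function.update_self]
        congr 1
        refine List.map_congr_left fun y hy => ?_
        rw [Function.update_of_ne (ne_of_mem_of_not_mem hy hx)]
      rw [hmap] at ht
      have hlen := ht.length_le
      simp only [List.length_cons, List.length_append] at hlen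
      refine ⟨t + 1, ht.weaken ?_ ?_ ?_⟩
      · intro A hA
        simp only [List.mem_cons, List.mem_append] at hA ⊢
        tauto
      · intro A hA
        simp only [List.mem_cons] at hA
        rcases hA with rfl | rfl | hA
        · exact base_litForm Q _
        · exact hΦ
        · exact ht.base A (by simp [hA])
      · simp only [List.length_cons, List.length_map]; omega
    obtain ⟨t₀, h₀⟩ := son false
    obtain ⟨t₁, h₁⟩ := son true
    have e₀ : litForm (x, !false) = PropForm.var x := rfl
    have e₁ : litForm (x, !true) = PropForm.neg (PropForm.var x) := rfl
    rw [e₀] at h₀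
    rw [e₁] at h₁
    exact ⟨_, Sq.cut h₀ h₁⟩

end Construction

/-! ### Refutation completeness of bounded-depth `textbookFrege` -/

/-- **Every unsatisfiable CNF has a depth-`30` `textbookFrege` refutation**: if `φ : CNF ℕ` is
unsatisfiable then `¬ ofCNF φ` has a `textbookFrege`-proof all of whose lines have alternation
depth `≤ 30` (the brute-force decision tree over `x₀, …, x_{numVars φ - 1}`; size `2^{O(n)}·|φ|`,
not recorded).  In particular the `π`-quantifier of the depth-`d` Frege rungs of route
`ExpanderLinearGenerators` is inhabited for every `d ≥ 30`.
[Krajíček 1995, §4.3–4.4 (bounded-depth Frege proves every tautology by brute force);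
Shoenfield 1967, §3.1] [folklore] -/
theorem exists_isDepthProofOf_neg_ofCNF {φ : CNF ℕ} (hφ : ¬ φ.Satisfiable) :
    ∃ π, textbookFrege.IsDepthProofOf 30 π (PropForm.neg (PropForm.ofCNF φ)) := by
  let Q : SPrm :=
    { D := 4, M := (PropForm.ofCNF φ).size + 1, Λ := 64 * (φ.numVars + 3 + 4), W := φ.numVars + 3,
      hΛ := le_rfl, hM := by have := (PropForm.ofCNF φ).size_pos; omega, hD := by norm_num }
  have hΦ : Base Q (PropForm.neg (PropForm.ofCNF φ)) :=
    ⟨altDepth_neg_ofCNF_le φ, by simp [Q, PropForm.size]⟩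
  obtain ⟨t, ht⟩ := sq_tree hφ hΦ (List.range φ.numVars) [] (fun _ => false)
    (by simpa using List.nodup_range)
    (fun c hc l hl => by simpa using CNF.lt_numVars_of_mem_of_mem hc hl)
    (by simp [Q])
  obtain ⟨π, hπ, -⟩ := Sq.extract ht
  exact ⟨π, hπ⟩

/-- Monotone form: depth-`d` refutations exist for every `d ≥ 30`. [folklore] -/
theorem exists_isDepthProofOf_neg_ofCNF_of_le {φ : CNF ℕ} (hφ : ¬ φ.Satisfiable) {d : ℕ}
    (hd : 30 ≤ d) : ∃ π, textbookFrege.IsDepthProofOf d π (PropForm.neg (PropForm.ofCNF φ)) := by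
  obtain ⟨π, hπ, hdepth⟩ := exists_isDepthProofOf_neg_ofCNF hφ
  exact ⟨π, hπ, fun ψ hψ => (hdepth ψ hψ).trans hd⟩

/-- The same refutation read in `textbookFrege(MOD_a)` (no `MOD_a` axiom used): every
unsatisfiable CNF has a depth-`d` `F(MOD_a)`-proof of `ofPropForm (¬ ofCNF φ)` for all `d ≥ 30`.
[Buss–Impagliazzo–Krajíček–Pudlák–Razborov–Sgall 1997, Def. 1.1 (`F ⊆ F(MOD_a)`)] [folklore] -/
theorem exists_isModDepthProofOf_neg_ofCNF {a : ℕ} {φ : CNF ℕ} (hφ : ¬ φ.Satisfiable) {d : ℕ}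
    (hd : 30 ≤ d) :
    ∃ π : List (PropFormMod a ℕ), textbookFrege.IsModDepthProofOf d π
      (PropFormMod.ofPropForm (PropForm.neg (PropForm.ofCNF φ))) := by
  obtain ⟨π, hπ⟩ := exists_isDepthProofOf_neg_ofCNF_of_le hφ hd
  exact ⟨_, hπ.isModDepthProofOf_map⟩

/-- **Calibration of the `AC⁰[p]` rung (`stmt-PneNP-11444`).** For every modulus `p`, every
UNSOLVABLE system `E` of linear equations over `𝔽₂` and every depth `d ≥ 30` there is a
depth-`d` `textbookFrege(MOD_p)` proof of the route target
`ofPropForm (¬ ofCNF (sumEncoding 1 E))`: the hypotheses of `LinearGeneratorModPFregeHard`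
(which include unsolvability) never make its `π`-quantifier empty once `d ≥ 30`, so from that
depth on the rung is a genuine exponential SIZE lower bound for `F_d(MOD_p)` — an instance of
Krajíček's Problem 15.6.1 — and not a vacuity. (For `d ≤ 4` the quantifier IS empty: the target
has alternation depth `4` and is only inferable by contraction from a depth-`5` line.)
[Krajíček 2019, *Proof Complexity*, Problem 15.6.1; Beck 2017, Def. 5.6 (`sumEncoding`)]
[folklore] -/
theorem exists_isModDepthProofOf_sumEncoding (p : ℕ) {m n : ℕ} (E : Fin m → LinEqMod 2 n)
    (hE : ¬ SystemSat E Finset.univ) {d : ℕ} (hd : 30 ≤ d) :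
    ∃ π : List (PropFormMod p ℕ), textbookFrege.IsModDepthProofOf d π
      (PropFormMod.ofPropForm (PropForm.neg (PropForm.ofCNF (sumEncoding 1 E)))) := by
  refine exists_isModDepthProofOf_neg_ofCNF (fun hsat => hE ?_) hd
  exact (sumEncoding_satisfiable_iff (p := 2) (B := 1) (by norm_num) (by norm_num) E).1 hsat

end Summit.PneNP.PneNP.Theorems
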